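import Literature.NumberTheory.LFunctions.MertensElementary
import Mathlib.NumberTheory.Harmonic.Bounds
import Mathlib.Algebra.BigOperators.Ring.Finset
import HarnessLib

/-!
# Hallgren 2005 / class numbers under GRH — step S5: the sums of Kalai's law
# (subsets of the composites, the telescoping product, Mertens' bound)

Topic `Literature/Computability/Cryptography`; proof companion of `HallgrenClassGroup.lean`
(named fact `Hallgren2005_classNumber_qsolvable_of_GRH`). Theorems only; no named fact.
The analytic half of the lower bound for the law of Kalai's generator (Kalai 2003) restricted to
sequences with DISTINCT composite elements. With `C = {composites in [4, N]}` and `f(c) = 1/c`: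

* `sum_powerset_prod` (`∑_{S ⊆ C} ∏_{c∈S} f = ∏_{c∈C} (1 + f)`), `sum_card_mul_prod_le`
  (`∑_S |S| ∏_S f ≤ (∑_C f) ∏_C (1 + f)`), **`sum_powerset_trunc_ge`** (the subsets of size
  `≤ L` carry the fraction `1 − (∑_C f)/(L+1)` of the total);
* `prod_Icc_one_sub_inv` (`∏_{2 ≤ j ≤ N} (1 − 1/j) = 1/N`), `prod_comp_one_sub_inv`
  (`∏_{c∈C} (1 − 1/c) = 1/(N ∏_{p ≤ N} (1 − 1/p))`), `prod_comp_one_add_inv_ge`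
  (`∏_C (1 + 1/c) ≥ (2/3) N ∏_{p ≤ N}(1 − 1/p)`), `sum_comp_inv_le_log` (`∑_C 1/c ≤ log N`),
  and, with the tree's Mertens bound `MertensBound.exp_neg_div_log_le_prod_one_sub_inv`,
  **`kalaiSum_ge : ∑_{S ⊆ C, |S| ≤ L} ∏_{c∈S} 1/c ≥ (4/9) N e^{−5}/log N`** for `L + 1 ≥ 3 log N`.

## References

* A. Kalai, *Generating random factored numbers, easily*, J. Cryptology 16 (2003) 287–289 [Kalai2003].
* G. H. Hardy, E. M. Wright, *An Introduction to the Theory of Numbers*, Thm 429 [HardyWright2008].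
-/

noncomputable section

namespace Literature.Computability.Cryptography.Hallgren2005

namespace KalaiSums

open Finset Real
open Literature.NumberTheory.LFunctions (MertensBound.sum_Ico_inv_mul_pred MertensBound.exp_neg_div_log_le_prod_one_sub_inv)

/-! ### Sums over subsets -/

/-- `∑_{S ⊆ C} ∏_{c∈S} f c = ∏_{c∈C} (1 + f c)`. [folklore] -/
theorem sum_powerset_prod {ι : Type*} (C : Finset ι) (f : ι → ℝ) :
    ∑ S ∈ C.powerset, ∏ c ∈ S, f c = ∏ c ∈ C, (1 + f c) := (prod_one_add C).symm

/-- Subsets containing a fixed element: `∑_{S ⊆ C, c₀ ∈ S} ∏_S f = f c₀ · ∏_{C ∖ c₀} (1 + f)`. [folklore] -/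
theorem sum_powerset_filter_mem_prod {ι : Type*} [DecidableEq ι] (C : Finset ι) (f : ι → ℝ) {c₀ : ι} (hc₀ : c₀ ∈ C) :
    ∑ S ∈ C.powerset.filter (fun S => c₀ ∈ S), ∏ c ∈ S, f c = f c₀ * ∏ c ∈ C.erase c₀, (1 + f c) := by
  rw [← sum_powerset_prod, mul_sum]
  symm
  refine sum_bij (fun (S' : Finset ι) _ => insert c₀ S') (fun S' hS' => ?_) (fun S₁ h₁ S₂ h₂ h => ?_) (fun S hS => ?_) (fun S' hS' => ?_)
  · rw [mem_powerset] at hS'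
    simp only [mem_filter, mem_powerset, mem_insert, true_or, and_true]
    exact insert_subset hc₀ (hS'.trans (erase_subset _ _))
  · rw [mem_powerset] at h₁ h₂
    have hn₁ : c₀ ∉ S₁ := fun h' => notMem_erase c₀ C (h₁ h')
    have hn₂ : c₀ ∉ S₂ := fun h' => notMem_erase c₀ C (h₂ h')
    rw [← erase_insert hn₁, ← erase_insert hn₂, h]
  · simp only [mem_filter, mem_powerset] at hS
    refine ⟨S.erase c₀, mem_powerset.2 (erase_subset_erase _ hS.1), ?_⟩
    rw [insert_erase hS.2]
  · rw [mem_powerset] at hS'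
    have hn : c₀ ∉ S' := fun h' => notMem_erase c₀ C (hS' h')
    rw [prod_insert hn]

/-- **`∑_S |S| ∏_S f ≤ (∑_C f) · ∏_C (1 + f)`** for `f ≥ 0`. [folklore] -/
theorem sum_card_mul_prod_le {ι : Type*} [DecidableEq ι] (C : Finset ι) (f : ι → ℝ) (hf : ∀ c ∈ C, 0 ≤ f c) :
    ∑ S ∈ C.powerset, (S.card : ℝ) * ∏ c ∈ S, f c ≤ (∑ c ∈ C, f c) * ∏ c ∈ C, (1 + f c) := by
  -- `|S| ∏_S f = ∑_{c₀ ∈ S} ∏_S f`, then swap the sums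
  have h1 : ∑ S ∈ C.powerset, (S.card : ℝ) * ∏ c ∈ S, f c = ∑ S ∈ C.powerset, ∑ _c₀ ∈ S, ∏ c ∈ S, f c := by
    refine sum_congr rfl fun S _ => ?_
    rw [sum_const, nsmul_eq_mul]
  rw [h1, sum_comm' (s' := fun c₀ => C.powerset.filter fun S => c₀ ∈ S) (t' := C) (fun S c₀ => by
    simp only [mem_powerset, mem_filter]
    exact ⟨fun ⟨h1, h2⟩ => ⟨⟨h1, h2⟩, h1 h2⟩, fun ⟨⟨h1, h2⟩, _⟩ => ⟨h1, h2⟩⟩)]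
  rw [sum_mul]
  refine sum_le_sum fun c₀ hc₀ => ?_
  rw [sum_powerset_filter_mem_prod C f hc₀]
  refine mul_le_mul_of_nonneg_left ?_ (hf c₀ hc₀)
  rw [← mul_prod_erase C (fun c => 1 + f c) hc₀]
  have hP : 0 ≤ ∏ c ∈ C.erase c₀, (1 + f c) := prod_nonneg fun c hc => by linarith [hf c (mem_of_mem_erase hc)]
  nlinarith [hf c₀ hc₀]

/-- **The truncated subset sum**: `∑_{S ⊆ C, |S| ≤ L} ∏_S f ≥ (1 − (∑_C f)/(L+1)) ∏_C (1 + f)` for `f ≥ 0`. [folklore] -/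
theorem sum_powerset_trunc_ge {ι : Type*} [DecidableEq ι] (C : Finset ι) (f : ι → ℝ) (hf : ∀ c ∈ C, 0 ≤ f c) (L : ℕ) :
    (1 - (∑ c ∈ C, f c) / (L + 1)) * (∏ c ∈ C, (1 + f c)) ≤ ∑ S ∈ C.powerset.filter (fun S => S.card ≤ L), ∏ c ∈ S, f c := by
  have hsplit := sum_filter_add_sum_filter_not C.powerset (fun S => S.card ≤ L) (fun S => ∏ c ∈ S, f c)
  rw [sum_powerset_prod] at hsplit
  -- the tail: `|S| ≥ L + 1` there
  have htail : ∑ S ∈ C.powerset.filter (fun S => ¬ S.card ≤ L), ∏ c ∈ S, f c ≤ ((∑ c ∈ C, f c) * ∏ c ∈ C, (1 + f c)) / (L + 1) := by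
    rw [le_div_iff₀ (by positivity)]
    calc (∑ S ∈ C.powerset.filter (fun S => ¬ S.card ≤ L), ∏ c ∈ S, f c) * (L + 1)
        = ∑ S ∈ C.powerset.filter (fun S => ¬ S.card ≤ L), (L + 1 : ℝ) * ∏ c ∈ S, f c := by rw [sum_mul]; refine sum_congr rfl fun _ _ => by ring
      _ ≤ ∑ S ∈ C.powerset.filter (fun S => ¬ S.card ≤ L), (S.card : ℝ) * ∏ c ∈ S, f c := by
          refine sum_le_sum fun S hS => ?_
          rw [mem_filter, not_le] at hS
          have hP : 0 ≤ ∏ c ∈ S, f c := prod_nonneg fun c hc => hf c (mem_powerset.1 hS.1 hc)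
          have : (L + 1 : ℝ) ≤ S.card := by exact_mod_cast hS.2
          nlinarith
      _ ≤ ∑ S ∈ C.powerset, (S.card : ℝ) * ∏ c ∈ S, f c :=
          sum_le_sum_of_subset_of_nonneg (filter_subset _ _) fun S hS _ => mul_nonneg (Nat.cast_nonneg _)
            (prod_nonneg fun c hc => hf c (mem_powerset.1 hS hc))
      _ ≤ (∑ c ∈ C, f c) * ∏ c ∈ C, (1 + f c) := sum_card_mul_prod_le C f hf
  have e1 : ∑ S ∈ C.powerset.filter (fun S => S.card ≤ L), ∏ c ∈ S, f c =
      (∏ c ∈ C, (1 + f c)) - ∑ S ∈ C.powerset.filter (fun S => ¬ S.card ≤ L), ∏ c ∈ S, f c := by linarith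
  rw [e1]
  have e2 : (1 - (∑ c ∈ C, f c) / (L + 1)) * (∏ c ∈ C, (1 + f c)) = (∏ c ∈ C, (1 + f c)) - ((∑ c ∈ C, f c) * ∏ c ∈ C, (1 + f c)) / (L + 1) := by ring
  rw [e2]
  linarith

/-! ### The composites in `[4, N]`, the telescoping product, Mertens -/

/-- The composite numbers in `[4, N]`. [folklore] -/
def compSet (N : ℕ) : Finset ℕ := (Icc 4 N).filter fun c => ¬ c.Prime

/-- `∏_{2 ≤ j ≤ N} (1 − 1/j) = 1/N` (`N ≥ 1`). [folklore] -/
theorem prod_Icc_one_sub_inv (N : ℕ) (hN : 1 ≤ N) : ∏ j ∈ Icc 2 N, (1 - 1 / (j : ℝ)) = 1 / N := by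
  induction N, hN using Nat.le_induction with
  | base => simp
  | succ N hN ih =>
    rw [Finset.prod_Icc_succ_top (by omega), ih]
    have hN0 : (N : ℝ) ≠ 0 := by exact_mod_cast (show N ≠ 0 by omega)
    push_cast
    field_simp
    ring

/-- `[2, N]` is the disjoint union of the primes `≤ N` and the composites in `[4, N]`. [folklore] -/
theorem Icc_two_eq_primes_union_comp (N : ℕ) : Icc 2 N = Nat.primesLE N ∪ compSet N ∧ Disjoint (Nat.primesLE N) (compSet N) := by
  constructor
  · ext j
    simp only [mem_Icc, mem_union, Nat.primesLE, Nat.primesBelow, mem_filter, mem_range, compSet]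
    constructor
    · rintro ⟨h2, hN⟩
      by_cases hp : j.Prime
      · exact Or.inl ⟨by omega, hp⟩
      · refine Or.inr ⟨⟨?_, hN⟩, hp⟩
        -- a non-prime `≥ 2` is `≥ 4`
        by_contra h4; push Not at h4
        interval_cases j
        · exact hp Nat.prime_two
        · exact hp Nat.prime_three
    · rintro (⟨h1, hp⟩ | ⟨⟨h4, hN⟩, _⟩)
      exacts [⟨hp.two_le, by omega⟩, ⟨by omega, hN⟩]
  · rw [disjoint_left]
    intro j hj hj'
    simp only [Nat.primesLE, Nat.primesBelow, mem_filter, compSet] at hj hj'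
    exact hj'.2 hj.2

/-- **`∏_{c ∈ C} (1 − 1/c) · (N ∏_{p ≤ N} (1 − 1/p)) = 1`** (`N ≥ 1`). [folklore] -/
theorem prod_comp_one_sub_inv (N : ℕ) (hN : 1 ≤ N) :
    (∏ c ∈ compSet N, (1 - 1 / (c : ℝ))) * ((N : ℝ) * ∏ p ∈ Nat.primesLE N, (1 - 1 / (p : ℝ))) = 1 := by
  obtain ⟨hU, hD⟩ := Icc_two_eq_primes_union_comp N
  have h := prod_Icc_one_sub_inv N hN
  rw [hU, prod_union hD] at h
  have hN0 : (N : ℝ) ≠ 0 := by exact_mod_cast (show N ≠ 0 by omega)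
  calc (∏ c ∈ compSet N, (1 - 1 / (c : ℝ))) * ((N : ℝ) * ∏ p ∈ Nat.primesLE N, (1 - 1 / (p : ℝ)))
      = N * ((∏ p ∈ Nat.primesLE N, (1 - 1 / (p : ℝ))) * ∏ c ∈ compSet N, (1 - 1 / (c : ℝ))) := by ring
    _ = N * (1 / N) := by rw [h]
    _ = 1 := by field_simp

/-- `∑_{c ∈ C} 1/c² ≤ 1/3` (compare with `∑_{j ≥ 4} 1/(j(j−1)) = 1/3 − 1/N`). [folklore] -/
theorem sum_comp_inv_sq_le (N : ℕ) : ∑ c ∈ compSet N, 1 / ((c : ℝ) ^ 2) ≤ 1 / 3 := by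
  rcases Nat.lt_or_ge N 4 with hN | hN
  · have : compSet N = ∅ := by
      rw [compSet, filter_eq_empty_iff]; intro c hc; rw [mem_Icc] at hc; omega
    rw [this, sum_empty]; norm_num
  have hIcc : Icc 4 N = Ico 4 (N + 1) := (Finset.Ico_add_one_right_eq_Icc 4 N).symm
  have hcons := sum_Ico_consecutive (fun j : ℕ => (1 : ℝ) / (j * (j - 1))) (show 2 ≤ 4 by norm_num) (show 4 ≤ N + 1 by omega)
  have htel := MertensBound.sum_Ico_inv_mul_pred N (by omega)
  have h24 : ∑ j ∈ Ico (2 : ℕ) 4, (1 : ℝ) / ((j : ℝ) * ((j : ℝ) - 1)) = 1 / 2 + 1 / 6 := by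
    rw [show Ico (2 : ℕ) 4 = {2, 3} by decide, sum_pair (by norm_num)]; norm_num
  calc ∑ c ∈ compSet N, 1 / ((c : ℝ) ^ 2) ≤ ∑ j ∈ Icc 4 N, 1 / ((j : ℝ) ^ 2) :=
        sum_le_sum_of_subset_of_nonneg (filter_subset _ _) fun _ _ _ => by positivity
    _ ≤ ∑ j ∈ Icc 4 N, (1 : ℝ) / (j * (j - 1)) := sum_le_sum fun j hj => by
        rw [mem_Icc] at hj
        have hj4 : (4 : ℝ) ≤ j := by exact_mod_cast hj.1
        rw [div_le_div_iff₀ (by positivity) (by nlinarith)]; nlinarith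
    _ = ∑ j ∈ Ico 4 (N + 1), (1 : ℝ) / (j * (j - 1)) := by rw [hIcc]
    _ = (1 - 1 / N) - (1 / 2 + 1 / 6) := by linarith
    _ ≤ 1 / 3 := by
        have : (0 : ℝ) ≤ 1 / N := by positivity
        linarith

/-- **`∏_{c∈C} (1 + 1/c) ≥ (2/3) N ∏_{p ≤ N} (1 − 1/p)`** (`N ≥ 1`). [folklore] -/
theorem prod_comp_one_add_inv_ge (N : ℕ) (hN : 1 ≤ N) :
    (2 / 3 : ℝ) * ((N : ℝ) * ∏ p ∈ Nat.primesLE N, (1 - 1 / (p : ℝ))) ≤ ∏ c ∈ compSet N, (1 + 1 / (c : ℝ)) := by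
  have hc4 : ∀ c ∈ compSet N, (4 : ℝ) ≤ c := fun c hc => by
    simp only [compSet, mem_filter, mem_Icc] at hc; exact_mod_cast hc.1.1
  have hsub : ∀ c ∈ compSet N, (0 : ℝ) < 1 - 1 / c := fun c hc => by
    have := hc4 c hc
    have : (1 : ℝ) / c ≤ 1 / 4 := by rw [div_le_div_iff₀ (by linarith) (by norm_num)]; linarith
    linarith
  -- `(1 + 1/c) = (1 − 1/c²)/(1 − 1/c)`
  have hfac : ∏ c ∈ compSet N, (1 + 1 / (c : ℝ)) = (∏ c ∈ compSet N, (1 - 1 / (c : ℝ) ^ 2)) / ∏ c ∈ compSet N, (1 - 1 / (c : ℝ)) := by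
    rw [eq_div_iff (prod_ne_zero_iff.2 fun c hc => (hsub c hc).ne'), ← prod_mul_distrib]
    refine prod_congr rfl fun c hc => ?_
    have := hc4 c hc
    field_simp
    ring
  -- Weierstrass: `∏ (1 − 1/c²) ≥ 1 − ∑ 1/c² ≥ 2/3`
  have hW : (2 / 3 : ℝ) ≤ ∏ c ∈ compSet N, (1 - 1 / (c : ℝ) ^ 2) := by
    have h1 : 1 - ∑ c ∈ compSet N, 1 / (c : ℝ) ^ 2 ≤ ∏ c ∈ compSet N, (1 - 1 / (c : ℝ) ^ 2) := by
      classical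
      -- Weierstrass by induction
      have key : ∀ s : Finset ℕ, (∀ c ∈ s, (4 : ℝ) ≤ c) → 1 - ∑ c ∈ s, 1 / (c : ℝ) ^ 2 ≤ ∏ c ∈ s, (1 - 1 / (c : ℝ) ^ 2) := by
        intro s hs
        induction s using Finset.induction_on with
        | empty => simp
        | insert a s has ih =>
          rw [sum_insert has, prod_insert has]
          have ha := hs a (mem_insert_self a s)
          have ih' := ih fun c hc => hs c (mem_insert_of_mem hc)
          have hx : 0 ≤ 1 / (a : ℝ) ^ 2 := by positivity
          have hx1 : 1 / (a : ℝ) ^ 2 ≤ 1 := by rw [div_le_one (by positivity)]; nlinarith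
          have hP1 : ∏ c ∈ s, (1 - 1 / (c : ℝ) ^ 2) ≤ 1 := prod_le_one (fun c hc => by
              have := hs c (mem_insert_of_mem hc)
              have : 1 / (c : ℝ) ^ 2 ≤ 1 := by rw [div_le_one (by positivity)]; nlinarith
              linarith) fun c hc => by
              have : 0 ≤ 1 / (c : ℝ) ^ 2 := by positivity
              linarith
          nlinarith
      exact key _ hc4
    linarith [sum_comp_inv_sq_le N]
  have hpos : 0 < ∏ c ∈ compSet N, (1 - 1 / (c : ℝ)) := prod_pos hsub
  have hkey := prod_comp_one_sub_inv N hN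
  -- `N ∏_p (1 − 1/p) = 1 / ∏_C (1 − 1/c)`
  have hNM : (N : ℝ) * ∏ p ∈ Nat.primesLE N, (1 - 1 / (p : ℝ)) = 1 / ∏ c ∈ compSet N, (1 - 1 / (c : ℝ)) := by
    rw [eq_div_iff hpos.ne', mul_comm]; exact hkey
  rw [hfac, hNM, le_div_iff₀ hpos]
  calc 2 / 3 * (1 / ∏ c ∈ compSet N, (1 - 1 / (c : ℝ))) * ∏ c ∈ compSet N, (1 - 1 / (c : ℝ)) = 2 / 3 := by field_simp
    _ ≤ _ := hW

/-- **`∑_{c∈C} 1/c ≤ log N`** (`N ≥ 1`; harmonic sum). [folklore] -/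
theorem sum_comp_inv_le_log (N : ℕ) (hN : 1 ≤ N) : ∑ c ∈ compSet N, 1 / (c : ℝ) ≤ Real.log N := by
  rcases Nat.lt_or_ge N 4 with hN4 | hN4
  · have : compSet N = ∅ := by
      rw [compSet, filter_eq_empty_iff]; intro c hc; rw [mem_Icc] at hc; omega
    rw [this, sum_empty]; exact Real.log_nonneg (by exact_mod_cast hN)
  have hharm := harmonic_le_one_add_log N
  rw [harmonic_eq_sum_Icc] at hharm
  push_cast at hharm
  have h1 : ∑ c ∈ compSet N, 1 / (c : ℝ) ≤ ∑ j ∈ Icc 4 N, 1 / (j : ℝ) :=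
    sum_le_sum_of_subset_of_nonneg (filter_subset _ _) fun _ _ _ => by positivity
  have hI1 : Icc 1 N = Ico 1 (N + 1) := (Finset.Ico_add_one_right_eq_Icc 1 N).symm
  have hI4 : Icc 4 N = Ico 4 (N + 1) := (Finset.Ico_add_one_right_eq_Icc 4 N).symm
  have hcons := sum_Ico_consecutive (fun j : ℕ => ((j : ℝ))⁻¹) (show 1 ≤ 4 by norm_num) (show 4 ≤ N + 1 by omega)
  have h13 : ∑ j ∈ Ico (1 : ℕ) 4, ((j : ℝ))⁻¹ = 1 + 1 / 2 + 1 / 3 := by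
    rw [show Ico (1 : ℕ) 4 = {1, 2, 3} by decide, sum_insert (by decide), sum_pair (by norm_num)]; norm_num
  have h4 : ∑ j ∈ Icc 4 N, 1 / (j : ℝ) = ∑ j ∈ Ico 4 (N + 1), ((j : ℝ))⁻¹ := by
    rw [hI4]; exact sum_congr rfl fun _ _ => one_div _
  rw [hI1] at hharm
  linarith

/-- **The Kalai sum**: `∑_{S ⊆ C, |S| ≤ L} ∏_{c∈S} 1/c ≥ (4/9) e^{−5} N / log N` for `N ≥ 2` and
`L + 1 ≥ 3 log N`. [cite: HardyWright2008, Thm 429 (§22.8)] -/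
theorem kalaiSum_ge (N L : ℕ) (hN : 2 ≤ N) (hL : 3 * Real.log N ≤ L + 1) :
    (4 / 9 : ℝ) * Real.exp (-5) * N / Real.log N ≤
      ∑ S ∈ (compSet N).powerset.filter (fun S => S.card ≤ L), ∏ c ∈ S, 1 / (c : ℝ) := by
  classical
  have hN1 : 1 ≤ N := by omega
  have hlog : 0 < Real.log N := Real.log_pos (by exact_mod_cast (show 1 < N by omega))
  have htr := sum_powerset_trunc_ge (compSet N) (fun c => 1 / (c : ℝ)) (fun _ _ => by positivity) L
  have hH := sum_comp_inv_le_log N hN1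
  have hfrac : (2 / 3 : ℝ) ≤ 1 - (∑ c ∈ compSet N, 1 / (c : ℝ)) / (L + 1) := by
    have hL0 : (0 : ℝ) < L + 1 := by positivity
    rw [le_sub_comm, div_le_iff₀ hL0]
    nlinarith
  have hP := prod_comp_one_add_inv_ge N hN1
  have hM := MertensBound.exp_neg_div_log_le_prod_one_sub_inv N hN
  have hPpos : 0 ≤ ∏ c ∈ compSet N, (1 + 1 / (c : ℝ)) := prod_nonneg fun _ _ => by positivity
  calc (4 / 9 : ℝ) * Real.exp (-5) * N / Real.log N = (2 / 3) * ((2 / 3) * (N * (Real.exp (-5) / Real.log N))) := by ring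
    _ ≤ (2 / 3) * ((2 / 3) * (N * ∏ p ∈ Nat.primesLE N, (1 - 1 / (p : ℝ)))) := by gcongr
    _ ≤ (2 / 3) * ∏ c ∈ compSet N, (1 + 1 / (c : ℝ)) := by gcongr
    _ ≤ (1 - (∑ c ∈ compSet N, 1 / (c : ℝ)) / (L + 1)) * ∏ c ∈ compSet N, (1 + 1 / (c : ℝ)) :=
        mul_le_mul_of_nonneg_right hfrac hPpos
    _ ≤ _ := htr

end KalaiSums

end Literature.Computability.Cryptography.Hallgren2005

end
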